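import Mathlib
import HarnessLib
import HarnessLib.Audit
import Summits.NavierStokesRegularity.Statement
import Literature.Analysis.FluidPDE.ClassicalSolution
import Literature.Analysis.FluidPDE.LerayHopf
import Literature.Analysis.FluidPDE.NSWave0
import Literature.Analysis.FluidPDE.SuitableWeak
import Literature.Analysis.FluidPDE.SelfSimilar
import Literature.Analysis.FluidPDE.LocalTypeI
import Literature.Analysis.FluidPDE.VectorCalculus
import Literature.Analysis.FluidPDE.Vorticity
import Literature.Analysis.FluidPDE.SereginSverak2002PressureLowerBound
import Literature.Analysis.FluidPDE.NSBoundedMildOseen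
import Literature.Analysis.UnboundedOperators.HeatKernel
import HarnessLib.Audit.Status.Attr

/-!
Route: LocalVelCompTubeDoor

CLOSED (proved) 2026-08-26T18:54:40Z by operator:999:3566880 — reason: proved:Summit.NavierStokesRegularity.NavierStokesRegularity.Theorems.LocalVelCompTubeDoorTarget.target_proof. The file is kept as the record of this route; refuted decls are indexed as negative knowledge (`ledger negatives`).

# Route LocalVelCompTubeDoor — local Type I plus ONE fading Cartesian VELOCITY component over one
similarity window forces regularity — via local velocity zoom and the Ertel collapse of
strict-shadow Type-I profiles

RUNG-LEAF ROUTE (D-0061; leaf = the proposed rung N0-LocalTubeDoorVelComp of LADDER-NS = this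
route's own `Target` item, the ONE-VELOCITY-COMPONENT WINDOW DOOR of cell nsreg-p1 ROUND-9; it does
NOT claim Clay (A)). It suffices to show X = K1′ ∧ K2′ where K1′ = LocalPointZoomVelSlices: at a
point x₀ where a classical Leray–Hopf flow is LOCALLY Type I (one parabolic cylinder) but not
backward bounded, some zoom sequence λ_j → 0⁺ of unit-viscosity rescalings (λ_j/ν)·u(T + λ_j²s/ν, x₀
+ λ_j y) converges pointwise, at EVERY slice s < 0, to a Type-I-rate, continuous, Oseen-mild,
divergence-free profile v on (−∞,0) × ℝ³ with backward-singular apex; and K2′ =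
VelCompWindowRigidity: such a profile cannot have, for one fixed e ≠ 0, on every slice a nonempty
open set where ⟪v(s,·), e⟫ = 0, unless its apex is regular. The leaf follows by the scale-critical
limit passage proved in glue.lean (`closes`, kernel-checked in the cell mock): along the zoom times
t_j = T + λ_j² s/ν the window velocity √(T−t_j)·u(t_j, x₀ + √(T−t_j)y) equals (σν)·[(λ_j/ν)u(·)(x₀ +
λ_j σy)], σ = √(−s)/√ν, so Fatou turns the fading of its e-component in L²(U) into ∫_U ⟪v(s, σy),
e⟫² dy = 0, continuity makes ⟪v(s,·), e⟫ vanish on the open set σ•U, and K2′ contradicts the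
singular apex.
Lean:
`Summit.NavierStokesRegularity.NavierStokesRegularity.Theses.LocalVelCompTubeDoor.LocalPointZoomVelSlices
∧
Summit.NavierStokesRegularity.NavierStokesRegularity.Theses.LocalVelCompTubeDoor.VelCompWindowRigidity`

## Assembly
An elementary limit passage (glue.lean, one theorem `closes`, ≈ 120 lines, kernel-checked in the
cell mock GlueScratch.lean, lean rc 0): fix the frame data, a window U, e ≠ 0 and the fading
hypothesis; suppose x₀ is not backward bounded; K1′ gives (C, v, λ_j) with slice-wise pointwise
convergence of the rescaled velocities; the profile's continuity clause gives continuity of every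
slice v(s,·). Fix s < 0 and zoom along t_j = T + λ_j² s/ν → T⁻ (eventually in (0,T), where u(t_j) is
smooth, so the window fields are measurable): the window velocity √(T−t_j)·u(t_j, x₀+√(T−t_j)y)
equals (σν)·[(λ_j/ν)u(·)(x₀ + λ_j σy)], σ = √(−s)/√ν, so it converges pointwise to (σν)·v(s, σy);
Fatou (`lintegral_liminf_le'`) and the fading hypothesis give ∫_U ⟪(σν) v(s, σy), e⟫² dy = 0; the
integrand is continuous and nonnegative, hence zero on the open set U, i.e. ⟪v(s,·), e⟫ = 0 on the
nonempty open set σ•U. This holds for every s < 0, so K2′ says the apex is not singular —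
contradicting K1′. (The deciding theorem is `closes`; the Assembly item below only records the
shape.)

CLOSES_TARGET: closes rung N0-LocalTubeDoorVelComp of NavierStokesRegularity: Summit.NavierStokesRegularity.NavierStokesRegularity.Theses.LocalVelCompTubeDoor.Target (D-0061; not the summit Statement) — the deciding theorem of this route concludes that registered leaf instead of the Statement decl `NavierStokesRegularity` (class rung: servable and labelled, never counted as concluding the summit Statement).

Rationale: WHY THIS LINE. The door reads a FIRST-ORDER quantity — one Cartesian component u·e of the velocity,
scale-normalised on ONE similarity window — where the sibling doors read the vorticity direction
(LocalSineTubeDoor, two-point sine coherence) or one vorticity component (staged PoloidalWindowDoor,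
crux K2 open). Its engine is the ERTEL LEDGER (cell ROUND-9): for an affine tracer λ = x·e the
potential vorticity q = ω·e satisfies D_t q − Δq = (ω·∇)(u·e) exactly, so on the zoom limit, where
u·e ≡ 0 after window-to-everywhere propagation by real analyticity of Oseen-mild bounded ancient
slices (tree `analyticOnNhd_slice_of_oseenMild`), q is a KNSS scalar with no stretching; KNSS 2009
Lemma 2.1 (arXiv:0709.3599 p. 5; tree `KNSS2009_lemma21_halfball_holds`, stated for a general
Euclidean space) plus the flux bound ∫_{B_R} q = O(R²) (q is slice-wise the planar curl of the
bounded field v_⊥; 3-D sibling of tree `false_of_curl2_ge_on_balls`) force ω·e ≡ 0; then v_⊥ is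
slice-wise curl- and divergence-free and bounded, hence a shear V(x·e, t) (tree
`apply_eq_apply_of_isDivFree_of_curl2_eq_zero`), whose vorticity is a bounded ancient 1-D caloric
function, hence constant (tree `heat_liouville` / `heat_liouville_ancient`), hence v is x-constant,
hence constant in time by the mild identity, hence 0 by the Type-I rate. Imported: the blow-up zoom
of Albritton–Barker arXiv:1811.00502 (local Type I ⇒ mild bounded ancient limit with singular apex;
tree item stmt-NavierStokesRegularity-20017 PROVED for the vorticity at s = −1), KNSS's
maximum-principle Liouville method (arXiv:0709.3599 Thms 5.1–5.2, pp. 9–10; p. 9 leaves ℝ³ open —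
the strict-shadow class {u·e ≡ 0} is the part of that question the planar proof still reaches). In
print, one-velocity-component REGULARITY CRITERIA are integrability conditions on parabolic
cylinders for general suitable solutions (Chae–Wolf arXiv:1911.02699; Wang–Wu–Zhang
doi:10.4171/aihpc/77, whose Rem. (3) leaves same-position blow-up open; Kang–Nguyen arXiv:2206.02490
Thm 1.2; under Type I, Bae–Kang doi:10.1016/j.aml.2019.02.024 with u₃ on the
Ladyzhenskaya–Prodi–Serrin line); the window-fading criterion under LOCAL Type I and the profile
statement K2′ are not among them. What it does that the cell's other routes do not: both cruxes are
PROVABLE NOW (K1′ = the landed zoom with its velocity clause exported; K2′ by the five-step chain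
above, kernel composition `velCompProfileRigidity_of` in the cell file r10/Sketch10.lean), so the
route is a second kernel-closable N0 door with a hypothesis disjoint in kind from
LocalSineTubeDoor's.

RANKED CRUXES. #0 Target (target) — the leaf LocalTubeDoorVelComp (cell r10/Sketch10.lean):
classical NS solution on [0,T), Leray–Hopf from a rapidly decaying datum, locally Type I at (x₀,T)
on B(x₀,ρ) × ((T−ρ²)∨0, T); if for ONE nonempty open window U of similarity coordinates and ONE
fixed e ≠ 0 the e-component of the scale-normalised window velocity fades in mean square, ∫_U
⟪√(T−t)·u(t, x₀+√(T−t)y), e⟫² dy → 0 as t → T⁻, then u is backward bounded at (x₀,T). (why it might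
fail: only through its cruxes: a locally Type-I singularity whose blow-up profiles lose one velocity
component near the window is excluded by K2′ (provable) once K1′ delivers the profile; the formal
risk is the velocity clause of the landed zoom.) [arXiv:0709.3599, arXiv:1811.00502,
arXiv:2206.02490, doi:10.4171/aihpc/77, doi:10.1016/j.aml.2019.02.024]
#2 VelCompWindowRigidity (crux) — RIGIDITY OF TYPE-I PROFILES LOSING ONE VELOCITY COMPONENT ON A
WINDOW. If v : (−∞,0) × ℝ³ → ℝ³ has the Type-I time rate ‖v(t,x)‖ ≤ C/√(−t), is continuous,
unit-viscosity Oseen-mild between negative times and divergence-free, then for every e ≠ 0: if every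
slice s < 0 carries a nonempty open set on which ⟪v(s,y), e⟫ = 0, then v is not backward-singular at
the apex (0,0). Proof plan (cell ROUND-9 §2, kernel composition `velCompProfileRigidity_of :
FirstIntegralCollapse → ShearProfileTrivial → VelCompProfileRigidity`): window ⇒ everywhere by slice
analyticity; rotate e to e₃; q = ω₃ solves q_t + v·∇q = Δq on every shifted sub-slab (stretching
term (ω·∇)v₃ = 0); KNSS Lemma 2.1 at ℝ³ + the 3-D flux bound ⇒ ω₃ ≡ 0; slice-wise planar div–curl
Liouville ⇒ shear V(x₃,t); vorticity of the shear is bounded ancient caloric ⇒ constant ⇒ 0; mild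
identity + Type-I rate ⇒ v ≡ 0. [difficulty: M] (why it might fail: not mathematically (five-step
KNSS chain); formally the sub-slab regularity class of `KNSS2009_lemma21_halfball` (C² slices,
bounded jointly continuous ∇q, Δq, integrated equation) must be met by ω₃ of an Oseen-mild Type-I
profile — ≈ 300 lines of bookkeeping.) [arXiv:0709.3599, doi:10.1016/j.aml.2019.02.024,
arXiv:2206.02490, arXiv:2606.11720]
#3 LocalPointZoomVelSlices (crux) — LOCAL POINT ZOOM LIMIT WITH VELOCITY SLICES. For a classical NS
solution on [0,T) (Leray–Hopf, rapidly decaying datum) that is locally Type I at (x₀,T) on one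
parabolic cylinder of radius ρ but NOT backward bounded at (x₀,T), there are C, a profile v and a
sequence λ_j → 0⁺ such that v has the Type-I time rate, is continuous on (−∞,0) × ℝ³, satisfies the
unit-viscosity Oseen–Duhamel identity between any two negative times, is divergence-free, is
backward-singular at the apex (0,0), and for EVERY s < 0 and every y the rescaled velocities
(λ_j/ν)·u(T + λ_j² s/ν, x₀ + λ_j y) converge to v(s, y). (= item stmt-NavierStokesRegularity-20017
`LocalPointZoom` of route LocalSineTubeDoor, PROVED, with the locally uniform velocity convergence
of its construction exported instead of the vorticity at s = −1.) [difficulty: M] (why it might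
fail: only if the landed proof of stmt-20017 (`localPointZoom_proof`) does not expose the locally
uniform velocity convergence of its Albritton–Barker zoom in its API — then one day of re-export, no
new mathematics.) [arXiv:1811.00502, arXiv:0709.3599, Seregin2014]

TWO-LAYER PLAN. Foreseen glued split of VelCompWindowRigidity (cell kernel
`velCompProfileRigidity_of`, r10/Sketch10.lean): stub_windowToEverywhere (slice analyticity
`analyticOnNhd_slice_of_oseenMild` + identity theorem: a window of vanishing ⟪v,e⟫ on every slice ⇒
⟪v,e⟫ ≡ 0; pattern = cell `poloidalWindowRigidity_iff`) → stub_rotate (rotation covariance of the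
profile class, reduce e to e₃; p422637 `CurlIsometryCovariance`) → stub_firstIntegralCollapse
(`FirstIntegralCollapse`: (ω·∇)(v·e₃) ≡ 0 ⇒ ω₃ ≡ 0, by KNSS Lemma 2.1 at ℝ³ + the 3-D flux lemma;
THE ONE NEW ANALYTIC PIECE, ≈ 300 lines) → stub_shearTrivial (`ShearProfileTrivial`: v₃ ≡ 0 ∧ ω₃ ≡ 0
⇒ shear ⇒ caloric ⇒ 0; ≈ 250 lines incl. `oseenDuhamel_const`) → VelCompWindowRigidity. Split of
LocalPointZoomVelSlices: none foreseen (re-export of the velocity clause of `localPointZoom_proof`).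

KILL CRITERIA. A refutation of VelCompWindowRigidity AS TYPED — a backward-singular Type-I
Oseen-mild profile with one Cartesian velocity component vanishing on a window of every slice —
closes the route (close --reason refuted:VelCompWindowRigidity); by the five-step chain no such
profile exists, so a refutation would expose a mis-typed profile class (shared with
LocalSineTubeDoor stmt-20018 and the staged PoloidalWindowDoor), forcing a re-typing across the
cell, not a pivot. A refutation of LocalPointZoomVelSlices as typed contradicts the landed
stmt-20017 construction unless the velocity clause is mis-stated (re-type). Proved elsewhere that
moots it: Bae–Kang 2019 / Kang–Nguyen 2022 may contain the strict-shadow Liouville step (then K2′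
closes by citation, the route stands as a corollary); local Type-I exclusion makes the leaf
vacuous-true; Clay (A) moots everything.

NOT DECOMPOSED YET. K2′ is kept as ONE crux although its proof has four stubs: three of them are
kernel or routine (window-to-everywhere, rotation, shear triviality) and the fourth (the Ertel
collapse) is a single KNSS argument; filing them as items would shred a provable-now M-sized crux.
The strict-shadow Liouville theorem in KNSS's own bounded-ancient class (`StrictShadowLiouville`,
cell Sketch10) is a by-product for Literature, not an item of this route. The velocity clause of the
zoom is one crux exactly as LocalSineTubeDoor's K1 (shared machinery).

CHEAPEST FALSIFIER. In-Lean (ran, kernel, cell r10/Sketch10.lean rc 0): `velCompProfileRigidity_of`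
reduces K2′ (profile form) to FirstIntegralCollapse + ShearProfileTrivial, and
`isFirstIntegralAlong_of_isVelOrthAlong` puts the strict-shadow class inside the first-integral
class — so a refuter must produce a Type-I Oseen-mild ancient solution with v·e ≡ 0 and ω·e ≢ 0,
i.e. a bounded (on sub-slabs) solution of the drift–diffusion equation q_t + v·∇q = Δq that is
slice-wise a planar curl of a bounded field and has positive supremum — exactly what KNSS Lemma 2.1
+ flux forbid (arXiv:0709.3599 p. 9). Lookup (ran): the explicit strict-2.5D families in print (Yu
arXiv:2606.11720 §1: V = (V_h(x_h,x₃,t), 0), «no vortex stretching» p. 29) contain no bounded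
ancient member other than shears, consistent with K2′. The refuter's only real test is LITERATURE:
whether doi:10.1016/j.aml.2019.02.024 (paywalled, acq-09211) already prints K2′'s profile form —
which closes the crux by citation rather than killing it.

NUMBERS. No thresholds: the leaf is qualitative and scale-invariant (window U of any size anywhere,
not required to contain y = 0; fading = o(1) in L²(U) of the dimensionless component √(T−t)⟪u,e⟫;
local Type-I constant M arbitrary). Printed comparators: Kang–Nguyen 2022 Thm 1.2 needs
‖v₃‖_{L^{p,q}(Q_r(z₀))} ≤ ε on a parabolic CYLINDER (all similarity radii at once) for (p,q) ∈
[1,∞]² under a scale-invariant bound 2/p₀ + 3/q₀ ∈ [1,2); Bae–Kang 2019 needs Type I + v₃ ∈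
L^p_tL^q_x with 2/p + 3/q = 1, q ∈ (3,∞]; Chae–Wolf 2021 needs 2/p + 3/q < 1; Wang–Wu–Zhang 2023 v₃
∈ L^{p,1}_tL^q_x. BC9 (ladder ceiling, for the tribunal): method_family = blow-up zoom + KNSS
maximum-principle scalar Liouville on a degeneracy stratum; ceiling in print = KNSS 2009 Thms
5.1/5.2 (planar, axisymmetric no-swirl) — capped at strata carrying a stretching-free scalar; the
strict-shadow stratum carries one (ω·e, by the Ertel identity), so the ladder reaches this leaf
uncapped; one rung above sits the poloidal stratum (staged PoloidalWindowDoor, crux K2) and above it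
the hard core (L) TypeIliouvilleL (stmt-10661), neither claimed.

DEFINITION REQUESTS. None: IsClassicalNSSolutionOn, IsLerayHopfOn, HasRapidSpatialDecay,
IsBackwardBoundedAt, IsBackwardSingularPoint, HasTypeITimeDecay, heatExtension, oseenDuhamel,
VectorCalculus.IsDivFree, ENNReal.ofReal, MeasureTheory.lintegral, inner all exist (lean search
--decl each; the three item texts elaborate in GlueScratch.lean, rc 0). Leaf registration request
(D-0061, LIST 3):
`Summit.NavierStokesRegularity.NavierStokesRegularity.Theses.LocalVelCompTubeDoor.Target` as rung
leaf N0-LocalTubeDoorVelComp (PATH (ii): the born item decl is the door) — director's MINT, not this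
seat's.

Novelty: Searches (2026-08-26 05:40–06:30Z, this seat): `lit search --hybrid "Liouville bounded ancient
Navier-Stokes one velocity component zero"` →
[corpus:book:seregin2014-lecture-notes-regularity-theory-navier-stokes-equations] /
[corpus:book:robinson2016] generic pages only — null; `lit search "Bae Kang one component Type I
Navier-Stokes regularity" --source local` → [corpus:paper:arxiv-2206.02490 p.3] (citing BK2019),
[corpus:paper:arxiv-1911.02699 p.14]; `lit galaxy search "one velocity component|one component
regularity|third component of the velocity" --star all` → 24 rows (medical Doppler, CFD manuals) —
null; `lit galaxy search "bounded ancient solution|Liouville theorem for the Navier|potential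
vorticity is conserved" --star all` → 21 rows (geophysical PV textbooks
[galaxy:panama:362478059913243] Swaters, [galaxy:panama:471200862044230] Holton) — null for NS
Liouville; OpenAlex/arXiv reads: [corpus:paper:arxiv-0709.3599 pp.5,8,9,10],
[corpus:paper:doi-10-4171-aihpc-77 pp.1–4], [corpus:paper:arxiv-2206.02490 p.4],
[corpus:paper:arxiv-2606.11720 chunks 2,3,29 — grep «Liouville|ancient» empty];
doi:10.1016/j.aml.2019.02.024 paywalled → acq-09211.
Nearest prior art found: Bae–Kang 2019 doi:10.1016/j.aml.2019.02.024 (Type I + v₃ ∈ L^pL^q on the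
LPS line ⇒ regular; its blow-up step is the nearest candidate for K2′'s profile form — text
requested); Kang–Nguyen 2022 arXiv:2206.02490 Thm 1.2 (cylinder ε-regularity in v₃ alone); KNSS 2009
arXiv:0709.3599 Thm 5.1 (planar) with p. 9 l  [refs: 10.1016/j.aml.2019.02.024, 2206.02490, 0709.3599, 2606.11720, book:seregin2014-lecture-notes-regularity-theory-navier-stokes-equations, book:robinson2016, paper:arxiv-2206.02490, paper:arxiv-1911.02699, paper:arxiv-0709.3599, paper:doi-10-4171-aihpc-77, paper:arxiv-2606.11720, doi:10.1016/j.aml.2019.02.024]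

Barriers (technique_class: velocity-component, zoom-compactness, knss-liouville): - technique_class: one-velocity-component, blow-up-zoom-compactness,
knss-maximum-principle-liouville, degeneracy-stratum, real-analyticity, type-I-criterion
- Literature.Barriers.NavierStokesRegularity.AveragedTypeIBlowup: OUTSIDE its class — the barrier
blocks Type-I EXCLUSION by averaging-insensitive (energy-identity + harmonic-analysis) arguments;
the leaf is a CRITERION whose engine is the vorticity transport identity D_t(ω·e) − Δ(ω·e) =
(ω·∇)(u·e) of the genuine bilinear form and KNSS's strong-maximum-principle Lemma 2.1 — Tao's
averaged bilinear form has no vorticity equation and no Ertel theorem, so «⟪u, e⟫ fading on a window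
⇒ ω·e is a stretching-free scalar» has no averaged counterpart; no claim is made about all frame
solutions.
- Literature.Barriers.NavierStokesRegularity.TaoAveragedBlowup: same placement (the mechanism is not
expressible for the averaged equation; the route does not assert regularity of every solution).
- Literature.Barriers.NavierStokesRegularity.HyperdissipativeAveragedBlowup: same family, same
placement.
- Literature.Barriers.NavierStokesRegularity.EnergySupercriticality: the added hypotheses are
scale-invariant (local Type I; the faded quantity √(T−t)⟪u,e⟫ on similarity windows is
dimensionless), so the criterion lives at critical scaling and does not pretend to control a
supercritical quantity from the energy class.
- Literature.Barriers.NavierStokesRegularity.LeraySelfSimilarBlowupExclusion: consistent — nothing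
in the line needs a self-sim

History (route lifecycle, newest last):
- 2026-08-26T18:10:53Z · closes_target -> closes rung N0-LocalTubeDoorVelComp of NavierStokesRegularity: Summit.NavierStokesRegularity.NavierStokesRegularity.Theses.LocalVelCompTubeDoor.Target (D-0061; not the summit Statement) (operator:999:438290)
- 2026-08-26T18:54:40Z · CLOSED proved — proved:Summit.NavierStokesRegularity.NavierStokesRegularity.Theorems.LocalVelCompTubeDoorTarget.target_proof (operator:999:3566880)

sub-problem: NavierStokesRegularity · status: closed(proved) · opened operator:999:4045461 2026-08-26T18:02:37Z · rev 2 · ledger route-NavierStokesRegularity-LocalVelCompTubeDoor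
GENERATED by the gate from the ledger (D-0016/17). Provers cite these decls: `theorem foo : Summit.NavierStokesRegularity.NavierStokesRegularity.Theses.LocalVelCompTubeDoor.<Decl> := …` in Summits/NavierStokesRegularity/NavierStokesRegularity/Theorems/<Name>.lean.
-/

namespace Summit.NavierStokesRegularity.NavierStokesRegularity.Theses.LocalVelCompTubeDoor

open scoped BigOperators Topology Manifold Classical MeasureTheory ProbabilityTheory Matrix InnerProductSpace ComplexConjugate ContinuousMap
open Filter Set Function TopologicalSpace MeasureTheory

attribute [summit_statement] _root_.NavierStokesRegularity
-- H21.Audit: the closer leaf Summit.NavierStokesRegularity.NavierStokesRegularity.Theses.LocalVelCompTubeDoor.Target is an item decl of this route file — tagged summit_statement below, after its declaration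

open Literature.NS

/-- item stmt-NavierStokesRegularity-19912 · crux · rank 2 · closed · proved by Summit.NavierStokesRegularity.NavierStokesRegularity.Theorems.LocalVelCompTubeDoorVelCompWindowRigidityClose.velCompWindowRigidity_proof (prover) · by operator
why it might fail: not mathematically (five-step KNSS chain); formally the sub-slab regularity class of `KNSS2009_lemma21_halfball` (C² slices, bounded jointly continuous ∇q, Δq, integrated equation) must be met by ω₃ of an Oseen-mild Type-I profile — ≈ 300 lines of bookkeeping.
sources: arXiv:0709.3599, doi:10.1016/j.aml.2019.02.024, arXiv:2206.02490, arXiv:2606.11720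
[crux] RIGIDITY OF TYPE-I PROFILES LOSING ONE VELOCITY COMPONENT ON A WINDOW. If v : (−∞,0) × ℝ³ →
ℝ³ has the Type-I time rate ‖v(t,x)‖ ≤ C/√(−t), is continuous, unit-viscosity Oseen-mild between
negative times and divergence-free, then for every e ≠ 0: if every slice s < 0 carries a nonempty
open set on which ⟪v(s,y), e⟫ = 0, then v is not backward-singular at the apex (0,0). Proof plan
(cell ROUND-9 §2, kernel composition `velCompProfileRigidity_of : FirstIntegralCollapse →
ShearProfileTrivial → VelCompProfileRigidity`): window ⇒ everywhere by slice analyticity; rotate e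
to e₃; q = ω₃ solves q_t + v·∇q = Δq on every shifted sub-slab (stretching term (ω·∇)v₃ = 0); KNSS
Lemma 2.1 at ℝ³ + the 3-D flux bound ⇒ ω₃ ≡ 0; slice-wise planar div–curl Liouville ⇒ shear V(x₃,t);
vorticity of the shear is bounded ancient caloric ⇒ constant ⇒ 0; mild identity + Type-I rate ⇒ v ≡
0. [difficulty: M] -/
@[route_item "route-NavierStokesRegularity-LocalVelCompTubeDoor", crux]
def VelCompWindowRigidity : Prop :=
  ∀ (C : ℝ) (v : ℝ → EuclideanSpace ℝ (Fin 3) → EuclideanSpace ℝ (Fin 3)), Literature.Analysis.FluidPDE.HasTypeITimeDecay C v → ContinuousOn (Function.uncurry v) (Set.Iio (0 : ℝ) ×ˢ Set.univ) → (∀ s t : ℝ, s < t → t < 0 → ∀ x, v t x = Literature.Analysis.UnboundedOperators.heatExtension (v s) (t - s) x - Literature.Analysis.FluidPDE.oseenDuhamel 1 s v v t x) → (∀ t < 0, Literature.Analysis.FluidPDE.VectorCalculus.IsDivFree (v t)) → ∀ (e : EuclideanSpace ℝ (Fin 3)), e ≠ 0 → (∀ s < 0, ∃ U : Set (EuclideanSpace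 ℝ (Fin 3)), IsOpen U ∧ U.Nonempty ∧ ∀ y ∈ U, inner ℝ (v s y) e = 0) → ¬ Literature.Analysis.FluidPDE.IsBackwardSingularPoint v 0

-- `VelCompWindowRigidity` holds: proved by `Summit.NavierStokesRegularity.NavierStokesRegularity.Theorems.LocalVelCompTubeDoorVelCompWindowRigidityClose.velCompWindowRigidity_proof` (its module imports this route file, so no `_holds` link can be stated here).

/-- item stmt-NavierStokesRegularity-19913 · crux · rank 3 · closed · proved by Summit.NavierStokesRegularity.NavierStokesRegularity.Theorems.LocalVelCompTubeDoorLocalPointZoomVelSlicesClose.localPointZoomVelSlices_proof (prover) · by operator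
why it might fail: only if the landed proof of stmt-20017 (`localPointZoom_proof`) does not expose the locally uniform velocity convergence of its Albritton–Barker zoom in its API — then one day of re-export, no new mathematics.
sources: arXiv:1811.00502, arXiv:0709.3599, Seregin2014
[crux] LOCAL POINT ZOOM LIMIT WITH VELOCITY SLICES. For a classical NS solution on [0,T)
(Leray–Hopf, rapidly decaying datum) that is locally Type I at (x₀,T) on one parabolic cylinder of
radius ρ but NOT backward bounded at (x₀,T), there are C, a profile v and a sequence λ_j → 0⁺ such
that v has the Type-I time rate, is continuous on (−∞,0) × ℝ³, satisfies the unit-viscosity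
Oseen–Duhamel identity between any two negative times, is divergence-free, is backward-singular at
the apex (0,0), and for EVERY s < 0 and every y the rescaled velocities (λ_j/ν)·u(T + λ_j² s/ν, x₀ +
λ_j y) converge to v(s, y). (= item stmt-NavierStokesRegularity-20017 `LocalPointZoom` of route
LocalSineTubeDoor, PROVED, with the locally uniform velocity convergence of its construction
exported instead of the vorticity at s = −1.) [difficulty: M] -/
@[route_item "route-NavierStokesRegularity-LocalVelCompTubeDoor", crux]
def LocalPointZoomVelSlices : Prop :=
  ∀ (ν T : ℝ), 0 < ν → 0 < T → ∀ (u : ℝ → EuclideanSpace ℝ (Fin 3) → EuclideanSpace ℝ (Fin 3)) (p : ℝ → EuclideanSpace ℝ (Fin 3) → ℝ), Literature.Analysis.FluidPDE.IsClassicalNSSolutionOn (Set.Ico 0 T) ν 0 u p → Literature.Analysis.FluidPDE.IsLerayHopfOn T ν 0 (u 0) u → Literature.Analysis.FluidPDE.HasRapidSpatialDecay (u 0) → ∀ (x₀ : EuclideanSpace ℝ (Fin 3)) (ρ M : ℝ), 0 < ρ → (∀ t ∈ Set.Ico 0 T, T - ρ ^ 2 < t → ∀ x ∈ Metric.ball x₀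 ρ, ‖u t x‖ * Real.sqrt (ν * (T - t)) ≤ M) → ¬ Literature.Analysis.FluidPDE.IsBackwardBoundedAt u T x₀ → ∃ (C : ℝ) (v : ℝ → EuclideanSpace ℝ (Fin 3) → EuclideanSpace ℝ (Fin 3)) (lam : ℕ → ℝ), (∀ j, 0 < lam j) ∧ Filter.Tendsto lam Filter.atTop (nhds 0) ∧ (Literature.Analysis.FluidPDE.HasTypeITimeDecay C v ∧ ContinuousOn (Function.uncurry v) (Set.Iio (0 : ℝ) ×ˢ Set.univ) ∧ (∀ s t : ℝ, s < t → t < 0 → ∀ x, v t x = Literature.Analysis.UnboundedOperators.heatExtension (v s) (t - s) x - Literature.Analysis.FluidPDE.oseenDuhamel 1 s v v t x) ∧ (∀ t < 0, Literature.Analysis.FluidPDE.VectorCalculus.IsDivFree (v t))) ∧ Literature.Analysis.FluidPDE.IsBackwardSingularPoint v 0 ∧ ∀ s < 0, ∀ y, Filter.Tendsto (fun j => (lam j / ν) • u (T + lam j ^ 2 * s / ν) (x₀ + lam j • y)) Filter.atTop (nhds (v s y))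

-- `LocalPointZoomVelSlices` holds: proved by `Summit.NavierStokesRegularity.NavierStokesRegularity.Theorems.LocalVelCompTubeDoorLocalPointZoomVelSlicesClose.localPointZoomVelSlices_proof` (its module imports this route file, so no `_holds` link can be stated here).

/-- item stmt-NavierStokesRegularity-19911 · aside · rank 0 · closed · proved by Summit.NavierStokesRegularity.NavierStokesRegularity.Theorems.LocalVelCompTubeDoorTarget.target_proof (prover) · by operator
why it might fail: only through its cruxes: a locally Type-I singularity whose blow-up profiles lose one velocity component near the window is excluded by K2′ (provable) once K1′ delivers the profile; the formal risk is the velocity clause of the landed zoom.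
sources: arXiv:0709.3599, arXiv:1811.00502, arXiv:2206.02490, doi:10.4171/aihpc/77, doi:10.1016/j.aml.2019.02.024
[target] the leaf LocalTubeDoorVelComp (cell r10/Sketch10.lean): classical NS solution on [0,T),
Leray–Hopf from a rapidly decaying datum, locally Type I at (x₀,T) on B(x₀,ρ) × ((T−ρ²)∨0, T); if
for ONE nonempty open window U of similarity coordinates and ONE fixed e ≠ 0 the e-component of the
scale-normalised window velocity fades in mean square, ∫_U ⟪√(T−t)·u(t, x₀+√(T−t)y), e⟫² dy → 0 as t
→ T⁻, then u is backward bounded at (x₀,T). -/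
@[route_item "route-NavierStokesRegularity-LocalVelCompTubeDoor"]
def Target : Prop :=
  ∀ (ν T : ℝ), 0 < ν → 0 < T → ∀ (u : ℝ → EuclideanSpace ℝ (Fin 3) → EuclideanSpace ℝ (Fin 3)) (p : ℝ → EuclideanSpace ℝ (Fin 3) → ℝ), Literature.Analysis.FluidPDE.IsClassicalNSSolutionOn (Set.Ico 0 T) ν 0 u p → Literature.Analysis.FluidPDE.IsLerayHopfOn T ν 0 (u 0) u → Literature.Analysis.FluidPDE.HasRapidSpatialDecay (u 0) → ∀ (x₀ : EuclideanSpace ℝ (Fin 3)) (ρ M : ℝ), 0 < ρ → (∀ t ∈ Set.Ico 0 T, T - ρ ^ 2 < t → ∀ x ∈ Metric.ball x₀ ρ, ‖u t x‖ * Real.sqrt (ν * (T - t)) ≤ M) → ∀ (U : Set (EuclideanSpace ℝ (Fin 3))), IsOpen U → U.Nonempty → ∀ (e : EuclideanSpace ℝ (Fin 3)), e ≠ 0 → Filter.Tendsto (fun t => ∫⁻ y in U, ENNReal.ofReal ((inner ℝ (Real.sqrt (T - t) • u t (x₀ + Real.sqrt (T - t) • y)) e) ^ 2)) (nhdsWithin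 T (Set.Iio T)) (nhds 0) → Literature.Analysis.FluidPDE.IsBackwardBoundedAt u T x₀

-- `Target` holds: proved by `Summit.NavierStokesRegularity.NavierStokesRegularity.Theorems.LocalVelCompTubeDoorTarget.target_proof` (its module imports this route file, so no `_holds` link can be stated here).

/-- item stmt-NavierStokesRegularity-19914 · assembly · rank 1 · closed · proved by Summit.NavierStokesRegularity.NavierStokesRegularity.Theorems.LocalVelCompTubeDoorAssembly.assembly_proof (prover) · by operator
sources: arXiv:1811.00502, arXiv:0709.3599
[assembly] LocalPointZoomVelSlices → VelCompWindowRigidity → the leaf LocalTubeDoorVelComp (Target). -/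
@[route_item "route-NavierStokesRegularity-LocalVelCompTubeDoor"]
def Assembly : Prop :=
  LocalPointZoomVelSlices → VelCompWindowRigidity → Target

-- `Assembly` holds: proved by `Summit.NavierStokesRegularity.NavierStokesRegularity.Theorems.LocalVelCompTubeDoorAssembly.assembly_proof` (its module imports this route file, so no `_holds` link can be stated here).

attribute [summit_statement] _root_.Summit.NavierStokesRegularity.NavierStokesRegularity.Theses.LocalVelCompTubeDoor.Target

/-! D-0027 §2.1 — DECIDING THEOREM (planner-authored via `route open/edit --closes-file`; by operator:999:4045461 2026-08-26T18:02:37Z) — ARCHIVED: route closed (proved) 2026-08-26T18:54:40Z; kept so importers keep building: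
its hypotheses are this route's items and its conclusion the registered leaf `Summit.NavierStokesRegularity.NavierStokesRegularity.Theses.LocalVelCompTubeDoor.Target` (rung N0-LocalTubeDoorVelComp, D-0061) (glue_lint), and it elaborates with this file. -/

/-- DECIDING THEOREM (self-contained: zoom bookkeeping + Fatou on `∫⁻` + a.e.-to-everywhere on an
open window; continuity of the limit slices comes from the profile class, rigidity from K2′). -/
@[closes "route-NavierStokesRegularity-LocalVelCompTubeDoor"] theorem closes (h₁ : LocalPointZoomVelSlices) (h₂ : VelCompWindowRigidity) : Target := by
  intro ν T hν hT u p hcl hLH hdec x₀ ρ M hρ hM U hU hUne e he hfade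
  by_contra hnot
  obtain ⟨C, v, lam, hlam, hlam0, ⟨hrate, hcont, hmild, hdiv⟩, hsing, hconv⟩ :=
    h₁ ν T hν hT u p hcl hLH hdec x₀ ρ M hρ hM hnot
  refine h₂ C v hrate hcont hmild hdiv e he (fun s hs => ?_) hsing
  -- ## fix a slice `s < 0`; zoom times `tⱼ = T + λⱼ² s/ν → T⁻`
  have hns : 0 < -s := neg_pos.2 hs
  obtain ⟨t, ht⟩ : ∃ t : ℕ → ℝ, ∀ j, t j = T + lam j ^ 2 * s / ν := ⟨_, fun j => rfl⟩
  have hTt : ∀ j, T - t j = lam j ^ 2 * (-s) / ν := fun j => by rw [ht j]; ring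
  have hc : ∀ j, 0 < lam j ^ 2 * (-s) / ν := fun j => div_pos (mul_pos (pow_pos (hlam j) 2) hns) hν
  have hc0 : Tendsto (fun j => lam j ^ 2 * (-s) / ν) atTop (𝓝 0) := by
    simpa using ((hlam0.pow 2).mul_const (-s)).div_const ν
  have htT : Tendsto t atTop (𝓝[<] T) := by
    refine tendsto_nhdsWithin_iff.2 ⟨?_, Eventually.of_forall fun j => ?_⟩
    · have h1 : Tendsto (fun j => T - lam j ^ 2 * (-s) / ν) atTop (𝓝 (T - 0)) :=
        tendsto_const_nhds.sub hc0
      rw [sub_zero] at h1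
      refine h1.congr fun j => ?_
      rw [ht j]; ring
    · show t j < T
      have h1 := hc j
      rw [← hTt j] at h1
      linarith
  -- eventually the zoom times lie in `(0, T)`, where `u(tⱼ)` is smooth; shift the sequence there
  have hev : ∀ᶠ j in atTop, t j ∈ Set.Ioo 0 T := htT.eventually (Ioo_mem_nhdsLT hT)
  obtain ⟨j₀, hj₀⟩ := eventually_atTop.1 hev
  have hshift : Tendsto (fun j : ℕ => j + j₀) atTop atTop := tendsto_add_atTop_nat j₀
  -- the fading hypothesis along the (shifted) zoom times
  have hfadej : Tendsto (fun j => ∫⁻ y in U, ENNReal.ofReal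
      ((inner ℝ (Real.sqrt (T - t (j + j₀)) • u (t (j + j₀)) (x₀ + Real.sqrt (T - t (j + j₀)) • y)) e) ^ 2))
      atTop (𝓝 0) := (hfade.comp htT).comp hshift
  -- ## the similarity scale along the zoom: `√(T − tⱼ) = λⱼ σ`, `σ = √(−s)/√ν`
  set σ : ℝ := Real.sqrt (-s) / Real.sqrt ν with hσ
  have hσpos : 0 < σ := div_pos (Real.sqrt_pos.2 hns) (Real.sqrt_pos.2 hν)
  have hsq : ∀ j, Real.sqrt (T - t j) = lam j * σ := by
    intro j
    rw [hTt j, hσ, Real.sqrt_div' _ hν.le, Real.sqrt_mul (pow_nonneg (hlam j).le 2),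
      Real.sqrt_sq (hlam j).le]
    ring
  -- the window velocity at time `tⱼ` is `σν`× the zoom velocity at the point `σ y`
  set W : ℕ → EuclideanSpace ℝ (Fin 3) → EuclideanSpace ℝ (Fin 3) := fun j y =>
    Real.sqrt (T - t (j + j₀)) • u (t (j + j₀)) (x₀ + Real.sqrt (T - t (j + j₀)) • y) with hWdef
  have hW : ∀ (j : ℕ) (y : EuclideanSpace ℝ (Fin 3)), W j y =
      (σ * ν) • ((lam (j + j₀) / ν) • u (T + lam (j + j₀) ^ 2 * s / ν)
        (x₀ + lam (j + j₀) • (σ • y))) := by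
    intro j y
    simp only [hWdef, hsq (j + j₀), smul_smul]
    rw [ht (j + j₀)]
    congr 1
    field_simp
  set ω : EuclideanSpace ℝ (Fin 3) → EuclideanSpace ℝ (Fin 3) := fun y =>
    (σ * ν) • v s (σ • y) with hωdef
  have hvs : Continuous (v s) := by
    have h1 : ContinuousOn (fun y : EuclideanSpace ℝ (Fin 3) => Function.uncurry v (s, y)) Set.univ :=
      hcont.comp_continuous (continuous_const.prodMk continuous_id) (fun y => ⟨hs, mem_univ _⟩)
        |>.continuousOn
    simpa [continuousOn_univ, Function.uncurry] using h1
  have hωcont : Continuous ω := (hvs.comp (continuous_const_smul σ)).const_smul (σ * ν)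
  have hconvW : ∀ y, Tendsto (fun j => W j y) atTop (𝓝 (ω y)) := by
    intro y
    have h := ((hconv s hs (σ • y)).comp hshift).const_smul (σ * ν)
    exact h.congr fun j => (hW j y).symm
  -- measurability of the `W j`: `u(tⱼ)` is smooth for the shifted times
  have hWm : ∀ j, Measurable (W j) := by
    intro j
    have hmem : t (j + j₀) ∈ Set.Ico 0 T :=
      ⟨(hj₀ (j + j₀) (Nat.le_add_left _ _)).1.le, (hj₀ (j + j₀) (Nat.le_add_left _ _)).2⟩
    have hu : Continuous (u (t (j + j₀))) := (hcl.contDiff_velocity hmem).continuous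
    have hφ : Continuous fun y : EuclideanSpace ℝ (Fin 3) => x₀ + Real.sqrt (T - t (j + j₀)) • y :=
      continuous_const.add (continuous_const_smul _)
    exact ((hu.comp hφ).const_smul (Real.sqrt (T - t (j + j₀)))).measurable
  -- ## FATOU: the faded component vanishes on the window in the limit
  have hφ : Continuous fun w : EuclideanSpace ℝ (Fin 3) => (inner ℝ w e) ^ 2 :=
    (continuous_id.inner continuous_const).pow 2
  set g : EuclideanSpace ℝ (Fin 3) → ENNReal := fun y => ENNReal.ofReal ((inner ℝ (ω y) e) ^ 2) with hg
  have hgc : Continuous g := ENNReal.continuous_ofReal.comp (hφ.comp hωcont)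
  have hgjm : ∀ j, Measurable fun y => ENNReal.ofReal ((inner ℝ (W j y) e) ^ 2) :=
    fun j => ENNReal.measurable_ofReal.comp (hφ.measurable.comp (hWm j))
  have hptw : ∀ y, Tendsto (fun j => ENNReal.ofReal ((inner ℝ (W j y) e) ^ 2)) atTop (𝓝 (g y)) :=
    fun y => ENNReal.tendsto_ofReal ((hφ.tendsto (ω y)).comp (hconvW y))
  have hF : ∫⁻ y in U, liminf (fun j => ENNReal.ofReal ((inner ℝ (W j y) e) ^ 2)) atTop ≤
      liminf (fun j => ∫⁻ y in U, ENNReal.ofReal ((inner ℝ (W j y) e) ^ 2)) atTop :=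
    lintegral_liminf_le' (fun j => (hgjm j).aemeasurable)
  have hlim : (fun y => liminf (fun j => ENNReal.ofReal ((inner ℝ (W j y) e) ^ 2)) atTop) = g :=
    funext fun y => (hptw y).liminf_eq
  have hfadeW : Tendsto (fun j => ∫⁻ y in U, ENNReal.ofReal ((inner ℝ (W j y) e) ^ 2)) atTop (𝓝 0) :=
    hfadej
  rw [hlim, hfadeW.liminf_eq] at hF
  have hint : ∫⁻ y in U, g y = 0 := le_antisymm hF bot_le
  have hae : ∀ᵐ y ∂(volume.restrict U), g y = 0 := (lintegral_eq_zero_iff hgc.measurable).1 hint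
  rw [ae_restrict_iff' hU.measurableSet] at hae
  have hzero : ∀ y ∈ U, g y = 0 := by
    intro y hy
    by_contra hne
    set O : Set (EuclideanSpace ℝ (Fin 3)) := U ∩ g ⁻¹' (Ioi 0) with hO
    have hOo : IsOpen O := hU.inter (isOpen_Ioi.preimage hgc)
    have hO0 : volume O = 0 := by
      rw [measure_eq_zero_iff_ae_notMem]
      filter_upwards [hae] with y' hy'
      rintro ⟨h1, h2⟩
      have := hy' h1
      simp only [mem_preimage, mem_Ioi, this, lt_self_iff_false] at h2
    have hOe : O = ∅ := (hOo.measure_eq_zero_iff volume).1 hO0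
    have hyO : y ∈ O := ⟨hy, by simpa [mem_preimage, mem_Ioi, pos_iff_ne_zero] using hne⟩
    rw [hOe] at hyO
    exact hyO
  -- ## back to profile coordinates: the window `σ • U`
  refine ⟨(fun z => σ⁻¹ • z) ⁻¹' U, hU.preimage (continuous_const_smul σ⁻¹), ?_, fun z hz => ?_⟩
  · obtain ⟨u₀, hu₀⟩ := hUne
    refine ⟨σ • u₀, ?_⟩
    show σ⁻¹ • (σ • u₀) ∈ U
    rwa [smul_smul, inv_mul_cancel₀ hσpos.ne', one_smul]
  · have h := hzero (σ⁻¹ • z) hz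
    simp only [hg, ENNReal.ofReal_eq_zero] at h
    have h0 : inner ℝ (ω (σ⁻¹ • z)) e = 0 :=
      pow_eq_zero_iff two_ne_zero |>.1 (le_antisymm h (sq_nonneg _))
    simp only [hωdef, smul_smul, mul_inv_cancel₀ hσpos.ne', one_smul, real_inner_smul_left] at h0
    exact (mul_eq_zero.1 h0).resolve_left (mul_ne_zero hσpos.ne' hν.ne')

end Summit.NavierStokesRegularity.NavierStokesRegularity.Theses.LocalVelCompTubeDoor
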